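import Mathlib.MeasureTheory.Function.UniformIntegrable
import Mathlib.Order.LiminfLimsup
import Literature.Analysis.FluidPDE.LerayHopf
import Literature.Analysis.FunctionSpaces.TorusTestFunction
import HarnessLib

/-!
# De Rosa–Park: no anomalous dissipation in two-dimensional incompressible fluids (Thm. 1.4 (T2),
Thm. 5.1)

L. De Rosa, J. Park, *No anomalous dissipation in two-dimensional incompressible fluids*,
arXiv:2403.04668 (**v3**, 30 Jun 2025; to appear in SIAM J. Math. Anal.), Thm. 1.4 pp. 3–4, Thm. 5.1
and Cor. 5.2 p. 16 (all locators page-confirmed on the v3 PDF, 2026-08-27; earlier versions number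
§5 differently — the tree's barrier prose "Thm. 5.1, Cor. 5.3 read at p. 13" refers to v1).
[`DeRosaPark2024`]

The paper is cited in prose by the summit's barrier catalogue
(`Literature.Barriers.AnomalousDissipation.ShearFlowViscositySelection`, `GravestModeLaminarAttractor`)
and by several `Summits/AnomalousDissipation` theses and disproofs as THE two-dimensional no-anomaly
theorem, and it is the mechanism behind the no-dissipation clause of Mescolini–Pitcho–Sorella, Thm. 1.4
(ii) (`MescoliniPitchoSorella2025_thm14`, their ref. [12]); it had no typed form.

Abstract (p. 1): "We prove that any sequence of vanishing viscosity Leray–Hopf solutions to the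
periodic two-dimensional incompressible Navier–Stokes equations does not display anomalous dissipation
if the initial vorticity is a measure with positive singular part. A key step in the proof is the use of
the Delort–Majda concentration-compactness argument to exclude formation of atoms in the vorticity
measure, which in particular implies that the limiting velocity is an admissible weak solution to Euler.
This is the first result proving absence of dissipation in a class of solutions in which the velocity
fails to be strongly compact in `L²` …"

**Definition 1.2** (p. 2, Leray–Hopf weak solutions). "Let `u₀^ν ∈ L²(T²)` be a given incompressible
vector field and `ν > 0`. We say that `u^ν ∈ L^∞([0,T]; L²(T²)) ∩ L²([0,T]; H¹(T²))` is a Leray–Hopf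
weak solution to (1.2) [`∂ₜu^ν + div(u^ν ⊗ u^ν) + ∇p^ν = νΔu^ν`, `div u^ν = 0`, `u^ν(·,0) = u₀^ν` on
`T² × (0,T)`] if `div u^ν = 0`, (1.3) [the weak formulation against divergence-free
`φ ∈ C¹_c(T² × [0,T))`] holds … and in addition `E_{u^ν}(t) + ν∫₀ᵗ∫_{T²}|∇u^ν(x,s)|² dx ds ≤ E_{u₀^ν}`
for a.e. `t ∈ [0,T]`. (1.4)" (`E_u(t) = ½∫|u(x,t)|²dx`.) "(1.5) the term anomalous dissipation refers
to `liminf_{ν→0} ν∫₀ᵀ∫_{T²}|∇u^ν(x,t)|² dx dt > 0`."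

**Theorem 1.4** (pp. 3–4, verbatim). "Let `{u₀^ν}_{ν>0} ⊂ L²(T²)` be a sequence of divergence-free
vector fields satisfying (H1) `{u₀^ν}_{ν>0}` is strongly compact in `L²(T²)`; (H2) `{ω₀^ν}_{ν>0}` is
bounded in `M(T²)` and it admits a decomposition `ω₀^ν = f₀^ν + Ω₀^ν` such that `{f₀^ν}_{ν>0}` is weakly
compact in `L¹(T²)` and `Ω₀^ν ≥ 0`. Let `{u^ν}_{ν>0}` be the corresponding sequence of Leray–Hopf
solutions to (1.2) with `ν → 0`. Then (T1) there exists a subsequence `{u^{νₙ}}ₙ` such that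
`u^{νₙ} ⇀* u` in `L^∞([0,T]; L²(T²))`, `u₀^{νₙ} → u₀` in `L²(T²)` and `u` is an admissible weak solution
to Euler with initial datum `u₀`. In addition, if `ω := curl u`, it holds
`‖ω(t)‖_{M(T²)} ≤ sup_{ν>0} ‖ω₀^ν‖_{M(T²)}` for a.e. `t ∈ [0,T]`; (T2) the full sequence does not display
anomalous dissipation, i.e. `limsup_{ν→0} ν∫₀ᵀ∫_{T²}|∇u^ν(x,t)|² dx dt = 0`."

**Theorem 5.1** (p. 16, verbatim). "Let `{u₀^ν}_{ν>0} ⊂ L²(T²)` be a sequence of divergence-free vector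
fields satisfying (H1) and let `{u^ν}_{ν>0}` be the corresponding sequence of Leray–Hopf solutions to
(1.2) with `ν → 0`. Assume that `{ω^ν}_{ν>0}` is bounded in `L^∞([0,T]; L¹(T²))`. If
`lim_{R→0} limsup_{ν→0} ∫₀ᵀ sup_{x₀∈T²} ∫_{B_R(x₀)} |ω^ν(x,t)| dx dt = 0`, (5.1) then
`limsup_{ν→0} ν∫₀ᵀ∫_{T²}|∇u^ν(x,t)|² dx dt = 0`." ("The proof of the previous theorem follows by the
very same argument of that of Proposition 4.1 without any modification. In Proposition 3.2 we have
proved that the assumption (H2) guarantees the validity of (5.1).")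

**Corollary 5.2** (p. 16): under (H1) and `L^∞_t L¹_x`-bounded vorticity,
`liminf_{ν→0} ν∫₀ᵀ∫|∇u^ν|² > 0` forces, along every subsequence, vorticity concentration
`lim_{R→0} limsup_n ∫₀ᵀ sup_{x₀} ∫_{B_R(x₀)} |ω^{νₙ}| > 0` (5.2) — the contrapositive of Thm. 5.1 along
subsequences; not transcribed separately.

## Contents

* `Torus.HasWeakPlanarCurl v ω` — **definition**: `ω ∈ L¹(T²)` is the distributional vorticity
  `curl v = ∂₀v₁ - ∂₁v₀` of a planar field `v`: `∫ (∂₀χ·v₁ - ∂₁χ·v₀) = -∫ χ ω` for every smooth `χ`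
  (the identity used inline, with this sign convention, by
  `Summits/…/Theorems/TwoAndHalfDTwohalfdNegWeakCurlWitness.lean`, `exists_weakCurl_datum`).
* `DeRosaPark2024.IsStronglyPrecompactData u₀` — **definition**: hypothesis (H1) for a family
  `ν ↦ u₀ ν` on `ν ∈ (0,1)` — each `u₀ ν ∈ L²(T²)` and every sequence `νₙ ∈ (0,1)` has a subsequence
  along which `u₀ νₙ` converges in `L²(T²)` (relative sequential compactness = relative compactness in
  the complete metric space `L²`).
* `DeRosaPark2024.NoAnomalousDissipation T u` — **definition**: the conclusion (T2)/(5.1)⇒,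
  `limsup_{ν→0} ν∫₀ᵀ‖∇u^ν(t)‖²_{L²} dt = 0`, i.e. `ν ∫₀ᵀ ‖∇u^ν‖² → 0` as `ν ↓ 0` (spectral
  `Torus.eGradNormSq`, the dissipation functional of `Torus.IsLerayHopfOn`).
* `DeRosaPark2024.vorticityConcentration T ω R` — **definition**: the concentration functional of
  (5.1) at radius `R`, `limsup_{ν→0} ∫₀ᵀ sup_{x₀∈T²} ∫_{B_R(x₀)} |ω^ν(x,t)| dx dt ∈ [0,∞]`.
* `DeRosaPark2024_thm14_T2` — **named fact**: Thm. 1.4 (T2) in the case `Ω₀^ν = 0` of (H2)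
  (absolutely continuous initial vorticities, weakly compact in `L¹`).
* `DeRosaPark2024_thm51` — **named fact**: Thm. 5.1.
* Amendment 1 (append-only): `Torus.HasWeakPlanarCurlDecomp v f Ω` — **definition** (`curl v = f dx + Ω`,
  `Ω` a finite nonnegative measure: the decomposition of (H2)); `DeRosaPark2024_thm14_T2_measure` —
  **named fact**: Thm. 1.4 (T2) under the FULL hypothesis (H2) (vortex sheets of distinguished sign).

## Rendering (faithfulness notes)

* Leray–Hopf solutions: the tree's `Torus.IsLerayHopfOn T ν 0 (u₀ ν) (u ν)` on `T² × [0,T)` (force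
  `0`) asks MORE than Def. 1.2 (energy inequalities from `0` for every `t` and from a.e. `s`, weak
  continuity, strong attainment of the datum, `L²_t H¹_x` spectrally) — every tree solution is a
  solution in the sense of Def. 1.2, so conclusions quantified over tree solutions are implied by the
  printed ones (in `2D` Leray–Hopf solutions are unique and smooth for `t > 0`, p. 2, so "the
  corresponding sequence" is every such selection). Families are indexed by `ν ∈ (0,1)` and limits
  `ν → 0` are taken along `𝓝[>] 0`.
* "Divergence-free" data: `Torus.IsWeaklyDivFree (u₀ ν)`; `u₀^ν ∈ L²`: `MemLp (u₀ ν) 2 volume`.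
* (H1) "strongly compact in `L²(T²)`" for a family of functions (not of `L²`-classes): relative
  sequential compactness in the `L²` pseudo-distance `eLpNorm (· - ·) 2`, see
  `IsStronglyPrecompactData`.
* (H2) is typed in the case `Ω₀^ν = 0`: the initial vorticities `ω₀^ν = curl u₀^ν` are `L¹` functions
  (`Torus.HasWeakPlanarCurl (u₀ ν) (ω₀ ν)`) forming a relatively weakly compact family in `L¹(T²)`,
  i.e. (Dunford–Pettis, as the paper itself reads it, §2.2 p. 5: "F ⊂ L¹(T²) is weakly compact in L¹
  if and only if F is equi-integrable", equi-integrability being the `ε`–`δ` condition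
  `|A| < δ ⇒ sup_{f∈F} ∫_A |f| < ε`) an equi-integrable and `L¹`-bounded family — Mathlib's
  `UniformIntegrable (fun ν : Ioo 0 1 => ω₀ ν) 1 volume` (which is exactly: measurable, `UnifIntegrable`
  = the `ε`–`δ` condition, uniformly bounded in `L¹`); boundedness in `M(T²)` is then automatic. This covers the
  advertised range "`ω₀ ∈ Lᵖ`, `p ≥ 1`" (p. 3) and in particular a FIXED datum with `curl u₀ ∈ L¹(T²)`
  (proved corollary in the companion file). NOT transcribed: the measure-valued case `Ω₀^ν ≥ 0`
  (vortex sheets of distinguished sign; needs measure-valued distributional curls), and (T1) (admissible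
  weak Euler limit with the vorticity-measure bound).
  `-- TODO(general form): (H2) with a nonnegative singular part Ω₀^ν ∈ M₊(T²) and conclusion (T1).`
* (T2) "`limsup_{ν→0} ν∫₀ᵀ∫|∇u^ν|² = 0`" for a nonnegative quantity: `Tendsto … (𝓝[>] 0) (𝓝 0)` of
  `ENNReal.ofReal ν * ∫⁻_{(0,T)} ‖∇u^ν(t)‖²` (`NoAnomalousDissipation`).
* Thm. 5.1: "`{ω^ν}` bounded in `L^∞([0,T]; L¹(T²))`" — a vorticity `ω ν t` with
  `Torus.HasWeakPlanarCurl (u ν t) (ω ν t)` for a.e. `t ∈ (0,T)` and `∫|ω ν t| ≤ M` for a.e. `t`, all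
  `ν ∈ (0,1)`; (5.1) with `limsup_{ν→0}` = `Filter.limsup _ (𝓝[>] 0)` in `[0,∞]` and the inner
  `∫₀ᵀ sup_{x₀} ∫_{B_R(x₀)}` as lower Lebesgue integrals/suprema (no measurability is asserted). Balls
  `B_R(x₀)` are those of Mathlib's metric on `UnitAddTorus (Fin 2) = Fin 2 → AddCircle 1` (sup of the
  quotient distances); the Euclidean balls of the paper satisfy `B^{euc}_R ⊆ B^{sup}_R ⊆ B^{euc}_{√2 R}`,
  so condition (5.1) — a limit `R → 0` of a supremum over centres — is the same condition.
* Not typed: Thm. 3.4 (Delort–Majda existence of admissible Euler limits, p. 9), Prop. 3.2, Prop. 4.1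
  (quantitative form), Remark 1.5 (dissipation controlled by the vorticity mass of `√ν`-disks), §6.

No instance or notation is introduced; `Torus.HasWeakPlanarCurl` is the only new notion (a `def` with
body; the tree had the identity only inline in a `Summits` theorem file, which Literature cannot import).
-/

open MeasureTheory Set Filter Topology Function Metric
open scoped ENNReal NNReal

namespace Literature.Analysis.FluidPDE

noncomputable section

open Literature.Analysis.FunctionSpaces

namespace Torus

/-- **Weak planar curl.** `ω` is the distributional vorticity `curl v = ∂₀v₁ - ∂₁v₀` of a planar field
`v : T² → ℝ²`, as an integrable function: `ω ∈ L¹(T²)` and `∫ (∂₀χ · v₁ - ∂₁χ · v₀) = -∫ χ ω` for every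
smooth test function `χ` (torus derivatives `Torus.partialDeriv`, smooth = `Torus.IsSmooth`). For
`v ∈ H¹` this is the pointwise a.e. `∂₀v₁ - ∂₁v₀`; De Rosa–Park, §1.1: "we will denote the vorticity by
`ω^ν := curl u^ν`". Same identity and sign convention as the inline weak curl of
`Summits/…/TwoAndHalfDTwohalfdNegWeakCurlWitness.lean`. [cite: DeRosaPark2024, §1.1 p. 3] -/
def HasWeakPlanarCurl (v : UnitAddTorus (Fin 2) → EuclideanSpace ℝ (Fin 2))
    (ω : UnitAddTorus (Fin 2) → ℝ) : Prop :=
  Integrable ω volume ∧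
    ∀ χ : UnitAddTorus (Fin 2) → ℝ, Torus.IsSmooth χ →
      ∫ x, (Torus.partialDeriv 0 χ x * v x 1 - Torus.partialDeriv 1 χ x * v x 0) = -∫ x, χ x * ω x

end Torus

namespace DeRosaPark2024

/-- **Hypothesis (H1)** (Thm. 1.4 p. 3): "`{u₀^ν}_{ν>0}` is strongly compact in `L²(T²)`", for a family
`ν ↦ u₀ ν` on `ν ∈ (0,1)`: every member is in `L²` and every sequence `νₙ ∈ (0,1)` has a subsequence
along which `u₀ νₙ` converges in `L²(T²)` to some `L²` field. [cite: DeRosaPark2024, Thm. 1.4 (H1) p. 3] -/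
def IsStronglyPrecompactData (u₀ : ℝ → UnitAddTorus (Fin 2) → EuclideanSpace ℝ (Fin 2)) : Prop :=
  (∀ ν ∈ Ioo (0 : ℝ) 1, MemLp (u₀ ν) 2 volume) ∧
    ∀ s : ℕ → ℝ, (∀ n, s n ∈ Ioo (0 : ℝ) 1) →
      ∃ φ : ℕ → ℕ, StrictMono φ ∧
        ∃ v : UnitAddTorus (Fin 2) → EuclideanSpace ℝ (Fin 2), MemLp v 2 volume ∧
          Tendsto (fun n => eLpNorm (u₀ (s (φ n)) - v) 2 volume) atTop (𝓝 0)

/-- **No anomalous dissipation** of a vanishing-viscosity family `ν ↦ u ν` on `[0,T]` ((T2) of Thm. 1.4,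
conclusion of Thm. 5.1; negation of (1.5)): `limsup_{ν→0} ν∫₀ᵀ∫_{T²}|∇u^ν|² dx dt = 0`, i.e.
`ν ∫₀ᵀ ‖∇u^ν(t)‖²_{L²} dt → 0` as `ν ↓ 0` (spectral `Torus.eGradNormSq`, the dissipation functional of
`Torus.IsLerayHopfOn`). [cite: DeRosaPark2024, Thm. 1.4 (T2) p. 4 and (1.5) p. 2] -/
def NoAnomalousDissipation (T : ℝ)
    (u : ℝ → ℝ → UnitAddTorus (Fin 2) → EuclideanSpace ℝ (Fin 2)) : Prop :=
  Tendsto (fun ν => ENNReal.ofReal ν * ∫⁻ t in Ioo 0 T, Torus.eGradNormSq (u ν t)) (𝓝[>] 0) (𝓝 0)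

/-- **The vorticity-concentration functional of (5.1)** at radius `R` (Thm. 5.1 p. 16):
`limsup_{ν→0} ∫₀ᵀ sup_{x₀∈T²} ∫_{B_R(x₀)} |ω^ν(x,t)| dx dt ∈ [0,∞]`, for a family of vorticities
`ω ν t x` (lower integrals and suprema; balls of the metric of `UnitAddTorus (Fin 2)`, equivalent to
Euclidean balls up to the factor `√2` in the radius, which does not affect the limit `R → 0`).
[cite: DeRosaPark2024, Thm. 5.1 (5.1) p. 16] -/
def vorticityConcentration (T : ℝ) (ω : ℝ → ℝ → UnitAddTorus (Fin 2) → ℝ) (R : ℝ) : ℝ≥0∞ :=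
  Filter.limsup
    (fun ν => ∫⁻ t in Ioo 0 T, ⨆ x₀ : UnitAddTorus (Fin 2), ∫⁻ x in ball x₀ R, ‖ω ν t x‖ₑ)
    (𝓝[>] (0 : ℝ))

end DeRosaPark2024

open DeRosaPark2024

/-- **De Rosa–Park 2024, Theorem 1.4 (T2), absolutely continuous initial vorticity**
(arXiv:2403.04668v3, pp. 3–4). Let `T > 0` and let `ν ↦ u₀ ν` (`ν ∈ (0,1)`) be divergence-free `L²(T²)`
data which are (H1) strongly precompact in `L²(T²)` (`IsStronglyPrecompactData`) and whose vorticities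
`ω₀ ν = curl (u₀ ν)` are `L¹` functions (`Torus.HasWeakPlanarCurl`) forming a relatively weakly compact
family in `L¹(T²)` — uniformly integrable and `L¹`-bounded, Mathlib's `UniformIntegrable … 1 volume`
((H2) with `Ω₀^ν = 0`). Then every family `ν ↦ u ν` of Leray–Hopf solutions of the unforced 2D
Navier–Stokes equations on `T² × [0,T)` with viscosity `ν` and datum `u₀ ν` (`Torus.IsLerayHopfOn T ν 0`)
displays no anomalous dissipation: `ν ∫₀ᵀ ‖∇u^ν‖²_{L²} dt → 0` as `ν ↓ 0` (`NoAnomalousDissipation`).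
The measure-valued case `Ω₀^ν ≥ 0` and conclusion (T1) are not transcribed (module docstring).
[cite: DeRosaPark2024, Thm. 1.4 pp. 3–4; Def. 1.2 and (1.5) p. 2] -/
def DeRosaPark2024_thm14_T2 : Prop :=
  ∀ (T : ℝ) (u₀ : ℝ → UnitAddTorus (Fin 2) → EuclideanSpace ℝ (Fin 2))
    (ω₀ : ℝ → UnitAddTorus (Fin 2) → ℝ), 0 < T →
    (∀ ν ∈ Ioo (0 : ℝ) 1, Torus.IsWeaklyDivFree (u₀ ν)) →
    IsStronglyPrecompactData u₀ →
    (∀ ν ∈ Ioo (0 : ℝ) 1, Torus.HasWeakPlanarCurl (u₀ ν) (ω₀ ν)) →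
    UniformIntegrable (fun ν : Ioo (0 : ℝ) 1 => ω₀ ν) 1 volume →
    ∀ u : ℝ → ℝ → UnitAddTorus (Fin 2) → EuclideanSpace ℝ (Fin 2),
      (∀ ν ∈ Ioo (0 : ℝ) 1, Torus.IsLerayHopfOn T ν 0 (u₀ ν) (u ν)) →
      NoAnomalousDissipation T u

/-- **De Rosa–Park 2024, Theorem 5.1** (arXiv:2403.04668v3, p. 16; "what is really needed to run the
argument"). Let `T > 0`, let `ν ↦ u₀ ν` (`ν ∈ (0,1)`) be divergence-free `L²(T²)` data satisfying (H1)
(`IsStronglyPrecompactData`), and let `ν ↦ u ν` be Leray–Hopf solutions of the unforced 2D Navier–Stokes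
equations with viscosity `ν` and datum `u₀ ν` on `T² × [0,T)`. Assume the vorticities `ω ν t = curl (u ν t)`
(`Torus.HasWeakPlanarCurl` at a.e. `t ∈ (0,T)`) are bounded in `L^∞([0,T]; L¹(T²))` — `∫|ω ν t| ≤ M` for
a.e. `t`, all `ν` — and do not concentrate on atoms: `lim_{R→0} limsup_{ν→0} ∫₀ᵀ sup_{x₀} ∫_{B_R(x₀)}
|ω^ν| dx dt = 0` ((5.1), `vorticityConcentration T ω R → 0` as `R ↓ 0`). Then there is no anomalous
dissipation: `ν∫₀ᵀ‖∇u^ν‖² → 0` as `ν ↓ 0`. [cite: DeRosaPark2024, Thm. 5.1 p. 16, (5.1)] -/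
def DeRosaPark2024_thm51 : Prop :=
  ∀ (T : ℝ) (u₀ : ℝ → UnitAddTorus (Fin 2) → EuclideanSpace ℝ (Fin 2))
    (u : ℝ → ℝ → UnitAddTorus (Fin 2) → EuclideanSpace ℝ (Fin 2))
    (ω : ℝ → ℝ → UnitAddTorus (Fin 2) → ℝ), 0 < T →
    (∀ ν ∈ Ioo (0 : ℝ) 1, Torus.IsWeaklyDivFree (u₀ ν)) →
    IsStronglyPrecompactData u₀ →
    (∀ ν ∈ Ioo (0 : ℝ) 1, Torus.IsLerayHopfOn T ν 0 (u₀ ν) (u ν)) →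
    (∀ ν ∈ Ioo (0 : ℝ) 1, ∀ᵐ t ∂(volume.restrict (Ioo 0 T)), Torus.HasWeakPlanarCurl (u ν t) (ω ν t)) →
    (∃ M : ℝ≥0∞, M < ∞ ∧ ∀ ν ∈ Ioo (0 : ℝ) 1,
      ∀ᵐ t ∂(volume.restrict (Ioo 0 T)), ∫⁻ x, ‖ω ν t x‖ₑ ≤ M) →
    Tendsto (vorticityConcentration T ω) (𝓝[>] 0) (𝓝 0) →
    NoAnomalousDissipation T u

/-! ### Amendment 1 (append-only): the measure-valued case of (H2) — vortex sheets of distinguished sign -/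

namespace Torus

/-- **Weak planar curl with a singular part.** The distributional vorticity of a planar field
`v : T² → ℝ²` is the signed measure `f dx + Ω` with `f ∈ L¹(T²)` and `Ω` a finite (nonnegative) Borel
measure on `T²`: `∫ (∂₀χ · v₁ - ∂₁χ · v₀) dx = -(∫ χ f dx + ∫ χ dΩ)` for every smooth `χ` — the
decomposition "`ω₀^ν = f₀^ν + Ω₀^ν` … `Ω₀^ν ≥ 0`" of hypothesis (H2) of De Rosa–Park, Thm. 1.4 (initial
data "of vortex sheet type, that is, `ω₀ ∈ M`", p. 3, with singular part of distinguished sign).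
`HasWeakPlanarCurl v ω` is the case `Ω = 0`. [cite: DeRosaPark2024, Thm. 1.4 (H2) p. 3] -/
def HasWeakPlanarCurlDecomp (v : UnitAddTorus (Fin 2) → EuclideanSpace ℝ (Fin 2))
    (f : UnitAddTorus (Fin 2) → ℝ) (Ω : Measure (UnitAddTorus (Fin 2))) : Prop :=
  Integrable f volume ∧ IsFiniteMeasure Ω ∧
    ∀ χ : UnitAddTorus (Fin 2) → ℝ, Torus.IsSmooth χ →
      ∫ x, (Torus.partialDeriv 0 χ x * v x 1 - Torus.partialDeriv 1 χ x * v x 0) =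
        -((∫ x, χ x * f x) + ∫ x, χ x ∂Ω)

end Torus

/-- **De Rosa–Park 2024, Theorem 1.4 (T2) — full hypothesis (H2), vortex sheets of distinguished sign**
(arXiv:2403.04668v3, pp. 3–4). Let `T > 0` and let `ν ↦ u₀ ν` (`ν ∈ (0,1)`) be divergence-free `L²(T²)`
data which are (H1) strongly precompact in `L²(T²)` (`IsStronglyPrecompactData`) and whose vorticities
decompose as (H2) `curl (u₀ ν) = f₀ ν dx + Ω₀ ν` (`Torus.HasWeakPlanarCurlDecomp`) with `{f₀ ν}` relatively
weakly compact in `L¹(T²)` — equi-integrable and `L¹`-bounded, Mathlib's `UniformIntegrable … 1 volume`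
(the paper's reading via Dunford–Pettis, §2.2 p. 5) — and nonnegative finite measures `Ω₀ ν` of bounded
mass `Ω₀ ν (T²) ≤ C` (so that `{ω₀^ν}` is bounded in `M(T²)`, and conversely boundedness in `M(T²)` of
`f₀^ν dx + Ω₀^ν` with `{f₀^ν}` bounded in `L¹` bounds the masses `Ω₀^ν(T²)`). Then every family
`ν ↦ u ν` of Leray–Hopf solutions of the unforced 2D Navier–Stokes equations with viscosity `ν` and datum
`u₀ ν` on `T² × [0,T)` (`Torus.IsLerayHopfOn T ν 0`) displays no anomalous dissipation:
`ν∫₀ᵀ‖∇u^ν‖²_{L²} dt → 0` as `ν ↓ 0` (`NoAnomalousDissipation`). Conclusion (T1) (admissible weak Euler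
limit along a subsequence with `‖ω(t)‖_M ≤ sup_ν ‖ω₀^ν‖_M`) is not transcribed. The case `Ω₀ ν = 0` is
`DeRosaPark2024_thm14_T2` (derived from this fact in the companion file).
[cite: DeRosaPark2024, Thm. 1.4 pp. 3–4, (H1)–(H2), (T2); §2.2 p. 5] -/
def DeRosaPark2024_thm14_T2_measure : Prop :=
  ∀ (T : ℝ) (u₀ : ℝ → UnitAddTorus (Fin 2) → EuclideanSpace ℝ (Fin 2))
    (f₀ : ℝ → UnitAddTorus (Fin 2) → ℝ) (Ω₀ : ℝ → Measure (UnitAddTorus (Fin 2))), 0 < T →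
    (∀ ν ∈ Ioo (0 : ℝ) 1, Torus.IsWeaklyDivFree (u₀ ν)) →
    IsStronglyPrecompactData u₀ →
    (∀ ν ∈ Ioo (0 : ℝ) 1, Torus.HasWeakPlanarCurlDecomp (u₀ ν) (f₀ ν) (Ω₀ ν)) →
    UniformIntegrable (fun ν : Ioo (0 : ℝ) 1 => f₀ ν) 1 volume →
    (∃ C : ℝ≥0∞, C < ∞ ∧ ∀ ν ∈ Ioo (0 : ℝ) 1, Ω₀ ν univ ≤ C) →
    ∀ u : ℝ → ℝ → UnitAddTorus (Fin 2) → EuclideanSpace ℝ (Fin 2),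
      (∀ ν ∈ Ioo (0 : ℝ) 1, Torus.IsLerayHopfOn T ν 0 (u₀ ν) (u ν)) →
      NoAnomalousDissipation T u

end

end Literature.Analysis.FluidPDE
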